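import Literature.NumberTheory.EllipticCurves.CongruenceNumber
import Literature.NumberTheory.DiophantineGeometry.FaltingsHeight
import Literature.NumberTheory.DiophantineGeometry.Conductor
import HarnessLib

/-!
# The congruence number and the modular degree are at most `N^{N/5}`; the resulting explicit
# height and discriminant bounds for all elliptic curves over `ℚ` (Murty–Pasten 2013, Thms 4.3, 7.1)

Topic `Literature/NumberTheory/EllipticCurves` (family `abc`, LADDER-ABC A1: the *modular method*).
This file TYPES, as cite-tagged named facts (`def … : Prop`, D-0014) in the tree's vocabulary
(`ModularForms.congruenceNumber`, `ModularForms.ModularParametrizationData`, the optimality phrasing of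
`ModularForms.modularDegree_dvd_congruenceNumber`, `WeierstrassCurve.faltingsHeight`,
`WeierstrassCurve.conductorNorm ℤ`, `WeierstrassCurve.minimalDiscriminantNorm ℤ`), the elliptic-curve
side of

* M. R. Murty, H. Pasten, *Modular forms and effective Diophantine approximation*, J. Number Theory
  **133** (2013) 3739–3754 [`MurtyPasten2013`] — version of record HELD (`paper:url-b819d9c52ca6`),
  read in full. The `S`-unit / `abc` consequences (Thms 1.1–1.2) are typed in
  `Literature/NumberTheory/DiophantineGeometry/SUnitAbcBoundsCongruenceNumber.lean`.

The printed chain (§§2–7): `i_N = [𝒪'_N : 𝕋'_N]` the index of the coprime Hecke algebra in its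
normalisation (§2); `log i_N ≤ (1/5) N log N` by a covolume/determinant estimate with the Deligne bound
and `dim ≤ (N+4)/12` (Prop. 3.4, **Thm 3.5**; asymptotically `(1/6) N log N + O(N log log N)`); the
congruence number `n_f` of a rational newform `f ∈ S₂(Γ₀(N))` divides `i_N` (**Thm 4.2**) and the
modular degree `m_f = deg(φ_f : X₀(N) → E_f)` of the optimal quotient divides `n_f` (Ribet,
**Thm 4.1**), whence **Thm 4.3**; then `12 h_F(E) > log|Δ_E| + 28.326` (**Thm 5.4**, from Thm 5.1 and
Lemmas 5.2–5.3 on `|Δ(τ)| Im(τ)⁶`), `½ log deg φ_f > h_F(E) − 10.096` (**Prop. 6.3**: Prop. 6.2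
`½ log deg p_E = h_F(E) + log ‖f‖ + log c_E`, `log ‖f‖ > −7.549`, `c_E ≥ 1`, Mazur–Kenku `deg ψ ≤ 163`),
and **Thm 7.1**.

## Contents (statements in print; nothing here is proved in the tree except the marked corollary)

* `MurtyPasten.log_congruenceNumber_le` — Thm 4.3 (with Thm 3.5 / 4.2): `log n_f ≤ (1/5) N log N`.
* `MurtyPasten.log_modularDegree_le` — Thm 4.3: `log m_f ≤ (1/5) N log N` (`m_f` = the degree of a
  modular parametrisation datum of MINIMAL degree among all data with the same newform, i.e. of the
  optimal quotient — the phrasing of `modularDegree_dvd_congruenceNumber`).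
* `MurtyPasten.log_congruenceNumber_modularDegree_asymptotic` — Thm 4.3, "as `N → ∞`":
  `≤ (1/6) N log N + O(N log log N)` for both.
* `MurtyPasten.faltingsHeight_lt` — Thm 7.1: `h_F(E) < 0.1 N log N + 11` for every `E/ℚ`.
* `MurtyPasten.log_minimalDiscriminant_lt` — Thm 7.1: `log|Δ_E| < 1.2 N log N + 93` (ERRATUM below).
* `MurtyPasten.height_discriminant_asymptotic` — Thm 7.1, "as we let `E` vary":
  `h_F(E) < (1/12) N log N + O(N log log N)` and `log|Δ_E| < N log N + O(N log log N)`.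
* PROVED: `MurtyPasten.log_minimalDiscriminant_lt_148_of_faltingsHeight_lt` — from the height clause and
  Pasten's `log|Δ_min| ≤ 12 h(E) + 16` (tree fact
  `WeierstrassCurve.log_minimalDiscriminantNorm_lt_faltingsHeight`): `log|Δ_E| < 1.2 N log N + 148`,
  the explicit discriminant bound the printed argument supports in the tree's normalisation.

## Faithfulness notes (read before discharging)

* NORMALISATION of `h_F`. MP's Thm 5.1 prints `12 h_F(E) = log|Δ_E| − log(|Δ(τ_E)| Im(τ_E)⁶) +
  12 log(2π)` with the `q`-normalised `Δ = q∏(1−qⁿ)²⁴`, citing Silverman 1986; Silverman's Prop. 1.1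
  (with `Δ(τ) = (2π)¹²q∏(1−qⁿ)²⁴`), rewritten for the `q`-normalised `Δ`, has `−12 log(2π)` — the form
  used by Pasten 2024 (§3: `log Δ_E ≤ 12 h(E) + 16`; (18.1)) and by the tree's
  `WeierstrassCurve.faltingsHeight` (Faltings' normalisation = Silverman's `h(E/ℚ)` = Pasten's `h(E)`,
  `faltingsHeight_eq_neg_half_log`), while MP's Prop. 6.2 (`½ log deg p_E = h_F + log‖f‖ + log c_E`)
  differs from the tree's proved Zagier identity `log deg φ = 2 log(2π c) + 2 log‖f‖ + 2 h(E)`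
  (`ModularParametrizationData.two_mul_faltingsHeight_eq`) by `log(2π)`. The facts below are recorded
  with the tree's `faltingsHeight`. Along the printed argument in this normalisation:
  `h(E) ≤ ½ log m_f + ½ log 163 + log(1/(2π)) + 7.549 < 0.1 N log N + 8.26` — so the HEIGHT clause
  of Thm 7.1 as typed (`+ 11`) is established by the printed proof; but
  `log|Δ_E| ≤ 12 h(E) + 15.8 < 1.2 N log N + 114.9`, NOT `+ 93`: the DISCRIMINANT clause is recorded
  verbatim (it is what is in print and what later papers quote) and flagged ERRATUM — it is not
  expected to be discharged along the printed proof (for `N ≫ 1` it follows from Pasten 2024, Thm 7.5,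
  tree fact `pasten_thm_7_5`: `log|Δ_E| < (1/4 + ε) N log N`). Dependents wanting an explicit
  constant should use `log_minimalDiscriminant_lt_148_of_faltingsHeight_lt` or
  `Literature.NumberTheory.EllipticCurves.pasten_thm_7_5_explicit`.
* `n_f` is the tree's `congruenceNumber` (Agashe–Ribet–Stein's definition (ii), `#S₂(ℤ)/(ℤf + (ℤf)^⊥)`,
  equal to MP's "largest `M` with `f ≡ g mod M`, `(f,g) = 0`, `g ∈ S_ℤ`" for a newform with integer
  coefficients; junk value `0` if the quotient were infinite, where `Real.log 0 = 0` makes the clause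
  trivially true — a weakening in the junk case only). "`f` a rational newform in `S₂(Γ₀(N))`" is
  rendered by the newform `D.f` of a modular parametrisation datum `D` of an elliptic curve `W/ℚ` at
  level `N` (`IsNewformOf`: a normalised newform of level `N` with `aₙ(f) = aₙ(W) ∈ ℤ`); every rational
  weight-`2` newform arises this way (Eichler–Shimura), so no generality is lost. `m_f` (degree of the
  optimal parametrisation `φ_f : X₀(N) → E_f`) is rendered as the degree of a datum minimal among all
  data with the same newform, exactly as in `modularDegree_dvd_congruenceNumber`.
* `O(N log log N)` clauses: absolute constant `K` and threshold `N₀` (`∃ K N₀, ∀ …, N₀ ≤ N → …`).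
* NOT typed: Thm 3.5 itself (`log i_N ≤ (1/5) N log N` — the coprime Hecke index `[𝒪'_N : 𝕋'_N]` has no
  carrier in the tree), Thm 4.2 (`n_f ∣ i_N`), Conj. 4.4 / Thm 4.5 (`log n'_f ≪ log N` — a CONJECTURE,
  not literature; it "implies Frey's modular degree conjecture", whose abc consequence is the tree's
  `abcLe_of_freyDegreeBound`), Lemmas 5.2–5.3 and Thm 5.4 (`q`-product bounds for `Δ(τ)` on the
  fundamental domain; cf. the tree facts `pasten2024_log_minimalDiscriminant_le`,
  `log_minimalDiscriminantNorm_lt_faltingsHeight`), Prop. 6.2/6.3 (in the tree as Zagier's identity and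
  `IsNewformOf.exp_div_le_peterssonProduct`).

## References

* [MurtyPasten2013] M. R. Murty, H. Pasten, J. Number Theory 133 (2013) 3739–3754: Notation 2.1,
  Lemma 2.2–2.3, Props. 3.1–3.4, Thm 3.5 (pp. 3742–3747); Thms 4.1–4.3, Conj. 4.4, Thm 4.5
  (pp. 3747–3748); Thm 5.1, Lemmas 5.2–5.3, Thm 5.4 (pp. 3748–3750); Thm 6.1, Props. 6.2–6.3
  (pp. 3750–3751); Thm 7.1 (p. 3751–3752).
* [PastenShimura2024] H. Pasten, J. Number Theory 254 (2024) = arXiv:1705.09251, §1.3 (1.2)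
  ("`h(E) ≪ N log N` with good implicit constants, by first bounding the modular degree"), §3, §7.4
  Thm 7.5 (the sharper `(1/48 + ε) N log N`), §18.1 Lemma 18.1.
* [AgasheRibetStein2012] A. Agashe, K. Ribet, W. Stein, §2.1 (congruence number), Thm 2.1 (Ribet).
-/

noncomputable section

open WeierstrassCurve

namespace Literature.NumberTheory.EllipticCurves

namespace MurtyPasten

open ModularForms

/-! ### Thm 4.3: the congruence number and the modular degree -/

/-- **Murty–Pasten 2013, Theorem 4.3 (congruence number; = Thm 3.5 + Thm 4.2).** "We have
`log m_f ≤ log n_f ≤ (1/5) N log N`" — here the clause for the congruence number `n_f` of a rational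
newform `f ∈ S₂(Γ₀(N))` (p. 3748; `n_f` "the largest positive integer `M` [such that] there is a cusp
form `g ∈ S_ℤ` such that `(f,g) = 0` and `f ≡ g mod M`", p. 3747), rendered with the tree's
`congruenceNumber` for the newform `D.f` of any modular parametrisation datum at level `N` (module
docstring). Printed proof: `n_f ∣ i_N` (Thm 4.2) and `log i_N ≤ (1/5) N log N` (Thm 3.5, a covolume
bound for the coprime Hecke algebra via Deligne's bound and `dim ≤ (N+4)/12`, with a Sage table for
`N ≤ 30`). [cite: MurtyPasten2013, Thm 4.3 (p. 3748) with Thm 3.5 (p. 3746) and Thm 4.2 (p. 3747)] -/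
def log_congruenceNumber_le : Prop :=
  ∀ (W : WeierstrassCurve ℚ) [W.IsElliptic] (N : ℕ) [NeZero N] (D : ModularParametrizationData W N),
    Real.log (congruenceNumber D.f) ≤ (1 / 5 : ℝ) * N * Real.log N

/-- **Murty–Pasten 2013, Theorem 4.3 (modular degree).** "`log m_f ≤ log n_f ≤ (1/5) N log N`" — the
clause for the modular degree `m_f = deg φ_f` of the optimal quotient `φ_f : X₀(N) → E_f` attached to
the rational newform `f` (p. 3747), rendered as in `modularDegree_dvd_congruenceNumber`: the degree
of a modular parametrisation datum `D` at level `N` which is minimal among all data (of all elliptic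
`W'/ℚ`) with the same newform. Printed proof: `m_f ∣ n_f` (Ribet, Thm 4.1) and the previous clause.
[cite: MurtyPasten2013, Thm 4.3 (p. 3748) with Thm 4.1 (p. 3747)] -/
def log_modularDegree_le : Prop :=
  ∀ (W : WeierstrassCurve ℚ) [W.IsElliptic] (N : ℕ) [NeZero N] (D : ModularParametrizationData W N),
    (∀ (W' : WeierstrassCurve ℚ) [W'.IsElliptic] (D' : ModularParametrizationData W' N),
        D'.f = D.f → D.modularDegree ≤ D'.modularDegree) →
      Real.log D.modularDegree ≤ (1 / 5 : ℝ) * N * Real.log N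

/-- **Murty–Pasten 2013, Theorem 4.3, asymptotic clause.** "Moreover, as `N → ∞` one has
`log m_f ≤ log n_f ≤ (1/6) N log N + O(N log logN)`" (from the second part of Prop. 3.4 / Thm 3.5),
rendered with an absolute constant `K` and a threshold `N₀`, for both the congruence number and the
(optimal) modular degree as in the two previous statements.
[cite: MurtyPasten2013, Thm 4.3 (p. 3748, second display)] -/
def log_congruenceNumber_modularDegree_asymptotic : Prop :=
  ∃ K : ℝ, ∃ N₀ : ℕ, ∀ (W : WeierstrassCurve ℚ) [W.IsElliptic] (N : ℕ) [NeZero N]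
    (D : ModularParametrizationData W N), N₀ ≤ N →
      Real.log (congruenceNumber D.f) ≤
          (1 / 6 : ℝ) * N * Real.log N + K * N * Real.log (Real.log N) ∧
        ((∀ (W' : WeierstrassCurve ℚ) [W'.IsElliptic] (D' : ModularParametrizationData W' N),
            D'.f = D.f → D.modularDegree ≤ D'.modularDegree) →
          Real.log D.modularDegree ≤ (1 / 6 : ℝ) * N * Real.log N + K * N * Real.log (Real.log N))

/-! ### Thm 7.1: explicit bounds for the Faltings height and the minimal discriminant -/

/-- **Murty–Pasten 2013, Theorem 7.1 (height clause).** "Let `E` be an elliptic curve defined over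
`ℚ` with minimal discriminant `Δ_E`, conductor `N` and Faltings height `h_F(E)`. Then we have
`h_F(E) < 0.1 N log N + 11`." Rendered with the tree's `WeierstrassCurve.faltingsHeight` (Faltings'
normalisation; see the module docstring, NORMALISATION: in this normalisation the printed argument —
Prop. 6.3 and Thm 4.3 — gives `< 0.1 N log N + 8.26`, so the clause as typed is established by the
printed proof) and `N = W.conductorNorm ℤ`. A THEOREM in print ("to the best of our knowledge, this
is the first unconditional result [of the shape `h_F(E) ≪` a function of `N_E`] for all elliptic curves
over `ℚ`, not only Frey curves", p. 3742). Superseded for `N ≫ 1` by Pasten 2024, Thm 7.5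
(`(1/48 + ε) N log N`).
[cite: MurtyPasten2013, Thm 7.1 (p. 3751)] -/
def faltingsHeight_lt : Prop :=
  ∀ (W : WeierstrassCurve ℚ) [W.IsElliptic],
    W.faltingsHeight <
      0.1 * (W.conductorNorm ℤ : ℝ) * Real.log (W.conductorNorm ℤ) + 11

/-- **Murty–Pasten 2013, Theorem 7.1 (discriminant clause).** "… and `log|Δ_E| < 1.2 N log N + 93`."
(`|Δ_E| = W.minimalDiscriminantNorm ℤ`, `N = W.conductorNorm ℤ`.) Printed proof: the height clause and
Thm 5.4 (`12 h_F(E) > log|Δ_E| + 28.326`). ERRATUM (module docstring): with Silverman's formula as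
corrected in Pasten 2024 (`log|Δ_E| ≤ 12 h(E) + 16`) the printed chain yields `+ 114.9`, not `+ 93`;
this `Prop` records the statement VERBATIM and is not expected to be discharged along the printed
proof (see `log_minimalDiscriminant_lt_148_of_faltingsHeight_lt` for the bound the argument supports,
and `pasten_thm_7_5_explicit` / `pasten_thm_7_5` for Pasten's sharper explicit and asymptotic bounds).
[cite: MurtyPasten2013, Thm 7.1 (p. 3751)] -/
def log_minimalDiscriminant_lt : Prop :=
  ∀ (W : WeierstrassCurve ℚ) [W.IsElliptic],
    Real.log (W.minimalDiscriminantNorm ℤ) <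
      1.2 * (W.conductorNorm ℤ : ℝ) * Real.log (W.conductorNorm ℤ) + 93

/-- **Murty–Pasten 2013, Theorem 7.1, asymptotic clauses.** "Moreover, as we let `E` vary, we have
`h_F(E) < (1/12) N log N + O(N log logN)` and `log|Δ_E| < N log N + O(N log log N)`" (any fixed
normalisation of the height changes only the `O`-term). Rendered with an absolute constant `K` and a
threshold `N₀` on the conductor. [cite: MurtyPasten2013, Thm 7.1 (p. 3752, second part)] -/
def height_discriminant_asymptotic : Prop :=
  ∃ K : ℝ, ∃ N₀ : ℕ, ∀ (W : WeierstrassCurve ℚ) [W.IsElliptic], N₀ ≤ W.conductorNorm ℤ →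
    W.faltingsHeight <
        (1 / 12 : ℝ) * (W.conductorNorm ℤ : ℝ) * Real.log (W.conductorNorm ℤ) +
          K * (W.conductorNorm ℤ : ℝ) * Real.log (Real.log (W.conductorNorm ℤ)) ∧
      Real.log (W.minimalDiscriminantNorm ℤ) <
        (W.conductorNorm ℤ : ℝ) * Real.log (W.conductorNorm ℤ) +
          K * (W.conductorNorm ℤ : ℝ) * Real.log (Real.log (W.conductorNorm ℤ))

/-! ### The discriminant bound the printed argument supports (PROVED from the height clause) -/

/-- **`log|Δ_E| < 1.2 N log N + 148`** (PROVED from the height clause of Thm 7.1 and Pasten's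
`log|Δ_min| < 12 h(E) + 16`, tree fact `WeierstrassCurve.log_minimalDiscriminantNorm_lt_faltingsHeight`):
the step "Using this bound and Theorem 5.4 we conclude" of the printed proof of Thm 7.1 (p. 3752), run
with the corrected normalisation (`12 · 11 + 16 = 148`).
[cite: MurtyPasten2013, Thm 7.1 (proof, p. 3752)] [cite: PastenShimura2024, §3 (log Δ_E ≤ 12h(E)+16) and Lemma 18.1] -/
theorem log_minimalDiscriminant_lt_148_of_faltingsHeight_lt (h : faltingsHeight_lt)
    (hS : WeierstrassCurve.log_minimalDiscriminantNorm_lt_faltingsHeight)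
    (W : WeierstrassCurve ℚ) [W.IsElliptic] :
    Real.log (W.minimalDiscriminantNorm ℤ) <
      1.2 * (W.conductorNorm ℤ : ℝ) * Real.log (W.conductorNorm ℤ) + 148 := by
  have h1 := h W
  have h2 := hS W
  rw [WeierstrassCurve.minimalDiscriminantNorm_ringOfIntegers_rat_holds W, Module.finrank_self,
    Nat.cast_one, inv_one, one_mul] at h2
  linarith

end MurtyPasten

end Literature.NumberTheory.EllipticCurves

end
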